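import Summits.BirchSwinnertonDyer.Rank1Residual.Additive.WildThreeRefinedKolyvagin

/-!
# O6 (wild additive `p = 3`) — the DIVISIBILITY half `T1⁺` is the only class-level input

Bookkeeping add-on to `WildThreeRefinedKolyvagin` (o6-r2, gen 4, item G4-1). With Kolyvagin's structure
theorem in the shape `KolyvaginStructureThreeShape` (`ord₃ #Ш(E/K) + 2·M_∞ = 2·ord₃[E(K):ℤP]`):

* `T1⁺` at a pair (`MinftyGe … t`, every Kolyvagin class `3^t`-divisible, `t = ord₃ ∏ c_q`) is the
  UPPER bound `ord₃ #Ш(E/K) + 2t ≤ 2·ord₃[E(K):ℤP]` (`shaUpper_of_structure_of_minftyGe`) — the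
  Euler-system direction (Jetchev 2008 Thm. 1.4 proves the `max_q ord_p c_q` form for `p ∤ N`);
* the INDIVISIBILITY half `T1⁻` is then equivalent to the LOWER bound
  `2·ord₃[E(K):ℤP] ≤ ord₃ #Ш(E/K) + 2t`, which (a) holds trivially on UNLOCKED pairs
  (`ord₃[E(K):ℤP] = t`, `indexIdentity_of_structure_of_minftyGe_of_unlocked`) and (b) on locked pairs is a
  per-pair DESCENT certificate (`#Sel₃`, `#Sel₉` lower bounds), never a class-level conjecture
  (`indexIdentity_of_structure_of_minftyGe_of_shaLower`).

Hence the class-closure of slot 2 needs exactly ONE conjectural class-level statement, `RKC3Divisibility`.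
All statements here are folklore arithmetic over the tree's predicates; nothing is asserted about curves.
-/

namespace Summit.BirchSwinnertonDyer.Rank1Residual.AdditiveThree

open scoped Classical
open Literature.NumberTheory.EllipticCurves Literature.NumberTheory.EllipticCurves.ModularForms
  WeierstrassCurve

section Mono

variable {N : ℕ} [NeZero N] {W : WeierstrassCurve ℚ} {K : Type} [Field K] [NumberField K]
  {Dt : ModularParametrizationData W N} {β : ℤ} {ι : K →+* ℂ} {n : ℕ}

/-- `3^{m'}`-divisible ⇒ `3^m`-divisible for `m ≤ m'`. [folklore] -/
theorem classDivisibleBy_mono (d : KolyvaginHeegnerData Dt β ι n) (M : ℕ) {m m' : ℕ} (h : m ≤ m')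
    (hd : ClassDivisibleBy d M m') : ClassDivisibleBy d M m := by
  obtain ⟨x, hx⟩ := hd
  obtain ⟨k, rfl⟩ := Nat.exists_eq_add_of_le h
  exact ⟨(3 ^ k) • x, by rw [hx, pow_add, mul_smul]⟩

/-- Every class is `3^0`-divisible. [folklore] -/
theorem classDivisibleBy_zero (d : KolyvaginHeegnerData Dt β ι n) (M : ℕ) : ClassDivisibleBy d M 0 :=
  ⟨d.kolyvaginClass Nat.prime_three M, by rw [pow_zero, one_smul]⟩

end Mono

section MinftyMono

variable (W : WeierstrassCurve ℚ) [W.IsGloballyMinimal] (K : Type) [Field K] [NumberField K]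
  [NeZero (W.conductorNorm ℤ)]
  (Dt : ModularParametrizationData W (W.conductorNorm ℤ)) (β : ℤ) (ι : K →+* ℂ)

/-- `M_∞ ≥ m'` ⇒ `M_∞ ≥ m` for `m ≤ m'`. [folklore] -/
theorem minftyGe_mono {m m' : ℕ} (h : m ≤ m') (hM : MinftyGe W K Dt β ι m') :
    MinftyGe W K Dt β ι m :=
  fun n d M hn h1 hM' => classDivisibleBy_mono d M h (hM n d M hn h1 hM')

/-- `M_∞ ≥ 0` always. [folklore] -/
theorem minftyGe_zero : MinftyGe W K Dt β ι 0 :=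
  fun _ d M _ _ _ => classDivisibleBy_zero d M

/-- `M_∞ ≥ t` and `M_∞ = m` ⇒ `t ≤ m`. [folklore] -/
theorem le_of_minftyGe_of_minftyEq {t m : ℕ} (ht : MinftyGe W K Dt β ι t)
    (hm : MinftyEq W K Dt β ι m) : t ≤ m := by
  by_contra h
  exact hm.2 (minftyGe_mono W K Dt β ι (by omega) ht)

/-- If `M_∞` is bounded (`¬ M_∞ ≥ B` for some `B` — automatic when `y_K` is non-torsion, `B = M₀ + 1`),
then `M_∞ = m` for some `m`. [folklore] -/
theorem exists_minftyEq_of_not_minftyGe {B : ℕ} (hB : ¬ MinftyGe W K Dt β ι B) :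
    ∃ m, MinftyEq W K Dt β ι m := by
  classical
  have hex : ∃ k, ¬ MinftyGe W K Dt β ι k := ⟨B, hB⟩
  have hk := Nat.find_spec hex
  have hpos : 0 < Nat.find hex := by
    by_contra h0
    have h00 : Nat.find hex = 0 := by omega
    exact (h00 ▸ hk) (minftyGe_zero W K Dt β ι)
  refine ⟨Nat.find hex - 1, ?_, ?_⟩
  · have := Nat.find_min hex (m := Nat.find hex - 1) (by omega)
    simpa using this
  · have h1 : Nat.find hex - 1 + 1 = Nat.find hex := by omega
    rw [h1]; exact hk

end MinftyMono

/-! ## The upper bound from `T1⁺`, and the two ways the lower bound is supplied -/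

/-- **`T1⁺` ⇒ the BSD-predicted UPPER bound on `Ш(E/K)[3^∞]`**: structure theorem + `M_∞ ≥ t` (+ `M_∞`
finite, witnessed by `MinftyEq … m`) give `ord₃ #Ш(E/K) + 2t ≤ 2·ord₃ [E(K):ℤP]`. (Jetchev 2008 Cor. 1.5
is this with `t = max_q ord_p c_q`, `p ∤ N`.) [folklore] -/
theorem shaUpper_of_structure_of_minftyGe
    (hS : KolyvaginStructureThreeShape)
    (W : WeierstrassCurve ℚ) [W.IsElliptic] [W.IsGloballyMinimal] (hρ : TowerSurjThree W)
    (K : Type) [Field K] [NumberField K] (hK : IsImaginaryQuadratic K)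
    (h3 : NumberField.discr K ≠ -3) (h4 : NumberField.discr K ≠ -4)
    [NeZero (W.conductorNorm ℤ)] (hHN : SatisfiesHeegnerHypothesis (W.conductorNorm ℤ) K)
    (Dt : ModularParametrizationData W (W.conductorNorm ℤ))
    (H : HeegnerDatum (W.conductorNorm ℤ) (NumberField.discr K)) (ι : K →+* ℂ)
    (P : (W.baseChange K).toAffine.Point)
    (hP : WeierstrassCurve.Affine.Point.map ι.toRatAlgHom P = heegnerPointComplex Dt H)
    (hnt : ¬ IsOfFinAddOrder P)
    (t : ℕ) (ht : MinftyGe W K Dt H.β ι t) (m : ℕ) (hm : MinftyEq W K Dt H.β ι m) :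
    Finite (W.baseChange K).sha ∧
      padicValNat 3 (W.baseChange K).shaOrder + 2 * t ≤
        2 * padicValNat 3 (AddSubgroup.zmultiples P).index := by
  obtain ⟨hfin, h⟩ := hS W hρ K hK h3 h4 hHN Dt H ι P hP hnt m hm
  have htm : t ≤ m := le_of_minftyGe_of_minftyEq W K Dt H.β ι ht hm
  exact ⟨hfin, by omega⟩

/-- **`T1⁺` + a per-pair LOWER bound ⇒ the index identity** (`2t + ord₃ #Ш(E/K) = 2·ord₃ [E(K):ℤP]`,
the conclusion shape of `indexIdentity_of_structure_of_minftyEq`): the lower bound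
`2·ord₃[E(K):ℤP] ≤ ord₃ #Ш(E/K) + 2t` is what a `3`-descent certificate on the pair supplies
(`#Ш(E/K)[3] ≥ …` from `#Sel₃(E/ℚ)·#Sel₃(E^{d_K}/ℚ)`). No indivisibility conjecture is used. [folklore] -/
theorem indexIdentity_of_structure_of_minftyGe_of_shaLower
    (hS : KolyvaginStructureThreeShape)
    (W : WeierstrassCurve ℚ) [W.IsElliptic] [W.IsGloballyMinimal] (hρ : TowerSurjThree W)
    (K : Type) [Field K] [NumberField K] (hK : IsImaginaryQuadratic K)
    (h3 : NumberField.discr K ≠ -3) (h4 : NumberField.discr K ≠ -4)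
    [NeZero (W.conductorNorm ℤ)] (hHN : SatisfiesHeegnerHypothesis (W.conductorNorm ℤ) K)
    (Dt : ModularParametrizationData W (W.conductorNorm ℤ))
    (H : HeegnerDatum (W.conductorNorm ℤ) (NumberField.discr K)) (ι : K →+* ℂ)
    (P : (W.baseChange K).toAffine.Point)
    (hP : WeierstrassCurve.Affine.Point.map ι.toRatAlgHom P = heegnerPointComplex Dt H)
    (hnt : ¬ IsOfFinAddOrder P)
    (t : ℕ) (ht : MinftyGe W K Dt H.β ι t) (m : ℕ) (hm : MinftyEq W K Dt H.β ι m)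
    (hlow : 2 * padicValNat 3 (AddSubgroup.zmultiples P).index ≤
      padicValNat 3 (W.baseChange K).shaOrder + 2 * t) :
    Finite (W.baseChange K).sha ∧
      2 * t + padicValNat 3 (W.baseChange K).shaOrder =
        2 * padicValNat 3 (AddSubgroup.zmultiples P).index := by
  obtain ⟨hfin, hup⟩ :=
    shaUpper_of_structure_of_minftyGe hS W hρ K hK h3 h4 hHN Dt H ι P hP hnt t ht m hm
  exact ⟨hfin, by omega⟩

/-- **UNLOCKED pairs need `T1⁺` only**: if `ord₃ [E(K):ℤP] = t` (the Heegner index carries no `3` beyond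
the Tamagawa product — the unlocked rows of the O6 census), then `T1⁺` at the pair already gives
`3 ∤ #Ш(E/K)` and the index identity; the indivisibility half is vacuous there. [folklore] -/
theorem indexIdentity_of_structure_of_minftyGe_of_unlocked
    (hS : KolyvaginStructureThreeShape)
    (W : WeierstrassCurve ℚ) [W.IsElliptic] [W.IsGloballyMinimal] (hρ : TowerSurjThree W)
    (K : Type) [Field K] [NumberField K] (hK : IsImaginaryQuadratic K)
    (h3 : NumberField.discr K ≠ -3) (h4 : NumberField.discr K ≠ -4)
    [NeZero (W.conductorNorm ℤ)] (hHN : SatisfiesHeegnerHypothesis (W.conductorNorm ℤ) K)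
    (Dt : ModularParametrizationData W (W.conductorNorm ℤ))
    (H : HeegnerDatum (W.conductorNorm ℤ) (NumberField.discr K)) (ι : K →+* ℂ)
    (P : (W.baseChange K).toAffine.Point)
    (hP : WeierstrassCurve.Affine.Point.map ι.toRatAlgHom P = heegnerPointComplex Dt H)
    (hnt : ¬ IsOfFinAddOrder P)
    (t : ℕ) (ht : MinftyGe W K Dt H.β ι t) (m : ℕ) (hm : MinftyEq W K Dt H.β ι m)
    (hunl : padicValNat 3 (AddSubgroup.zmultiples P).index = t) :
    Finite (W.baseChange K).sha ∧ padicValNat 3 (W.baseChange K).shaOrder = 0 ∧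
      2 * t + padicValNat 3 (W.baseChange K).shaOrder =
        2 * padicValNat 3 (AddSubgroup.zmultiples P).index := by
  obtain ⟨hfin, hup⟩ :=
    shaUpper_of_structure_of_minftyGe hS W hρ K hK h3 h4 hHN Dt H ι P hP hnt t ht m hm
  exact ⟨hfin, by omega, by omega⟩

/-- **`T1⁺` + lower bound ⇒ `M_∞ = t` exactly** (so the pair satisfies the full refined conjecture T1):
the converse bookkeeping, for the census ledger. [folklore] -/
theorem minftyEq_of_structure_of_minftyGe_of_shaLower
    (hS : KolyvaginStructureThreeShape)
    (W : WeierstrassCurve ℚ) [W.IsElliptic] [W.IsGloballyMinimal] (hρ : TowerSurjThree W)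
    (K : Type) [Field K] [NumberField K] (hK : IsImaginaryQuadratic K)
    (h3 : NumberField.discr K ≠ -3) (h4 : NumberField.discr K ≠ -4)
    [NeZero (W.conductorNorm ℤ)] (hHN : SatisfiesHeegnerHypothesis (W.conductorNorm ℤ) K)
    (Dt : ModularParametrizationData W (W.conductorNorm ℤ))
    (H : HeegnerDatum (W.conductorNorm ℤ) (NumberField.discr K)) (ι : K →+* ℂ)
    (P : (W.baseChange K).toAffine.Point)
    (hP : WeierstrassCurve.Affine.Point.map ι.toRatAlgHom P = heegnerPointComplex Dt H)
    (hnt : ¬ IsOfFinAddOrder P)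
    (t : ℕ) (ht : MinftyGe W K Dt H.β ι t) (m : ℕ) (hm : MinftyEq W K Dt H.β ι m)
    (hlow : 2 * padicValNat 3 (AddSubgroup.zmultiples P).index ≤
      padicValNat 3 (W.baseChange K).shaOrder + 2 * t) :
    MinftyEq W K Dt H.β ι t := by
  obtain ⟨_, h⟩ := hS W hρ K hK h3 h4 hHN Dt H ι P hP hnt m hm
  have htm : t ≤ m := le_of_minftyGe_of_minftyEq W K Dt H.β ι ht hm
  have hmt : m = t := by omega
  exact hmt ▸ hm

end Summit.BirchSwinnertonDyer.Rank1Residual.AdditiveThree
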